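import Mathlib
import Summits.ValiantsHypothesis.ValiantsHypothesis.Theorems.DivisionGapPerMultiplesHardStubTwoBandTable

/-!
# `DivisionGap.PerMultiplesHard` (stmt-ValiantsHypothesis-5068), line `uncharged-face-walk`:
two-band tables on a block (stub `stub_twoBandTableOn`)

Rows `A` and columns `B` form a block of the board `Fin n × Fin n`, `π` is a permutation of
`Fin n` with `π (B) = A`, `eA : Fin a ≃ A` is a cyclic order of `A` and
`ζ := (finRotate a).extendDomain eA` is the `a`-cycle `eA 0 → eA 1 → ⋯ → eA (a - 1) → eA 0` on `A`
(the identity off `A`).  If the margins `R'` (on `A`) and `C'` (on `B`) are balanced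
(`Σ_A R' = Σ_B C'`), pairwise close (`R' i ≤ C' j + W`, `C' j ≤ R' i + W`) and of offset `> a · W`
(`a · W + 1 ≤ R' i`), then there is a table `L : Fin n × Fin n →₀ ℕ` supported on the rows of `A`,
with row margins `R'` on `A` (and `0` off `A`), column margins `C'` on `B` (and `0` off `B`), all of
whose cells `(i, j)` satisfy `π j = i ∨ π j = ζ i`: row `i ∈ A` uses only the "pattern" column
`π⁻¹ i` and the "forward" column `π⁻¹ (ζ i)`.

Construction (`table_of_potential_on`, the block version of `TwoBandTable.table_of_potential`).
Put `L (i, π⁻¹ i) := R' i - y i`, `L (i, π⁻¹ (ζ i)) := y i` for `i ∈ A` and `0` elsewhere.  Rows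
are right as soon as `y ≤ R'` on `A`; the column `π⁻¹ (ζ i)` (`i ∈ A`) receives `R' (ζ i) - y (ζ i)`
from row `ζ i` and `y i` from row `i`, so the columns are right iff
`R' (ζ i) - y (ζ i) + y i = C' (π⁻¹ (ζ i))` for `i ∈ A`.  Reading `A` through `eA`, `ζ` becomes
`finRotate a`, and these equations are solved by `TwoBandTable.exists_potential` applied to the
defects `D k := R' (eA k) - C' (π⁻¹ (eA k)) ∈ [-W, W]` (which sum to `Σ_A R' - Σ_B C' = 0`): the
potential is at most `(a - 1) · W < a · W + 1 ≤ R'`, so the subtraction `R' i - y i` is genuine.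

-- adapted from Summits/ValiantsHypothesis/ValiantsHypothesis/Theorems/DivisionGapPerMultiplesHardStubTwoBandTable.lean
(`table_of_potential`, `stub_twoBandTable`)
-/

noncomputable section

-- `Summit.ValiantsHypothesis.ValiantsHypothesis.…` is the tree's mandated layout (Sub = Summit).
set_option linter.dupNamespace false

namespace Summit.ValiantsHypothesis.ValiantsHypothesis.Theorems.DivisionGap.PerMultiplesHard.TwoBandTableOn

open Finset
open scoped BigOperators

open Summit.ValiantsHypothesis.ValiantsHypothesis.Theorems.DivisionGap.PerMultiplesHard.TwoBandTable
  (exists_potential)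

/-! ### The table attached to a potential on a block -/

/-- **The block table attached to a potential.**  Let `π (B) = A` (`j ∈ B ↔ π j ∈ A`) and let the
permutation `ζ` preserve `A`.  Given `y ≤ R` on `A` satisfying the column equations
`R (ζ i) - y (ζ i) + y i = C (π⁻¹ (ζ i))` for `i ∈ A`, the table with `L (i, π⁻¹ i) = R i - y i`,
`L (i, π⁻¹ (ζ i)) = y i` for `i ∈ A` and zero elsewhere is supported on the cells `(i, j)` with
`i ∈ A` and `π j = i ∨ π j = ζ i`, has row margins `R` on `A` and `0` off `A`, and column margins
`C` on `B` and `0` off `B`. [folklore] -/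
theorem table_of_potential_on {n : ℕ} (A B : Finset (Fin n)) (π ζ : Equiv.Perm (Fin n))
    (hB : ∀ j, j ∈ B ↔ π j ∈ A) (hζ : ∀ i, ζ i ∈ A ↔ i ∈ A) (R C y : Fin n → ℕ)
    (hy : ∀ i ∈ A, y i ≤ R i)
    (hcol : ∀ i ∈ A, R (ζ i) - y (ζ i) + y i = C (π.symm (ζ i))) :
    ∃ L : (Fin n × Fin n) →₀ ℕ,
      (∀ e ∈ L.support, e.1 ∈ A ∧ (π e.2 = e.1 ∨ π e.2 = ζ e.1)) ∧
      (∀ i ∈ A, ∑ j, L (i, j) = R i) ∧ (∀ i ∉ A, ∑ j, L (i, j) = 0) ∧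
      (∀ j ∈ B, ∑ i, L (i, j) = C j) ∧ (∀ j ∉ B, ∑ i, L (i, j) = 0) := by
  refine ⟨Finsupp.equivFunOnFinite.symm fun e =>
      if e.1 ∈ A then
        (if e.2 = π.symm e.1 then R e.1 - y e.1 else 0) +
          (if e.2 = π.symm (ζ e.1) then y e.1 else 0)
      else 0, ?_, ?_, ?_, ?_, ?_⟩
  · -- the support lies on the pattern cells `(i, π⁻¹ i)` and the forward cells `(i, π⁻¹ (ζ i))`
    -- of the rows `i ∈ A`
    intro e he
    simp only [Finsupp.mem_support_iff, Finsupp.coe_equivFunOnFinite_symm] at he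
    by_cases h1 : e.1 ∈ A
    · refine ⟨h1, ?_⟩
      by_contra h
      obtain ⟨h2, h3⟩ := not_or.mp h
      refine he ?_
      rw [if_pos h1, if_neg fun h' => h2 (by rw [h', Equiv.apply_symm_apply]),
        if_neg fun h' => h3 (by rw [h', Equiv.apply_symm_apply])]
      rfl
    · exact absurd (if_neg h1) he
  · -- row `i ∈ A` carries `(R i - y i) + y i`
    intro i hi
    simp only [Finsupp.coe_equivFunOnFinite_symm, if_pos hi, Finset.sum_add_distrib,
      Finset.sum_ite_eq', Finset.mem_univ, if_true]
    exact Nat.sub_add_cancel (hy i hi)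
  · -- row `i ∉ A` is empty
    intro i hi
    simp only [Finsupp.coe_equivFunOnFinite_symm, if_neg hi, Finset.sum_const_zero]
  · -- column `j ∈ B` receives `R (π j) - y (π j)` from row `π j ∈ A` and `y (ζ⁻¹ (π j))` from
    -- row `ζ⁻¹ (π j) ∈ A`
    intro j hj
    have hA : π j ∈ A := (hB j).mp hj
    have hA' : ζ.symm (π j) ∈ A := by rw [← hζ, Equiv.apply_symm_apply]; exact hA
    simp only [Finsupp.coe_equivFunOnFinite_symm]
    rw [Finset.sum_ite_mem, Finset.univ_inter, Finset.sum_add_distrib]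
    have e2 : ∀ i : Fin n, j = π.symm (ζ i) ↔ ζ.symm (π j) = i :=
      fun i => by rw [Equiv.eq_symm_apply, Equiv.symm_apply_eq]
    have e1 : ∀ i : Fin n, j = π.symm i ↔ π j = i := fun i => Equiv.eq_symm_apply π
    simp_rw [e2, e1, Finset.sum_ite_eq, if_pos hA, if_pos hA']
    have h := hcol (ζ.symm (π j)) hA'
    rwa [Equiv.apply_symm_apply, Equiv.symm_apply_apply] at h
  · -- column `j ∉ B` is empty: `π j ∉ A` and `ζ⁻¹ (π j) ∉ A`
    intro j hj
    have hA : π j ∉ A := fun h => hj ((hB j).mpr h)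
    have hA' : ζ.symm (π j) ∉ A := by rwa [← hζ, Equiv.apply_symm_apply]
    simp only [Finsupp.coe_equivFunOnFinite_symm]
    rw [Finset.sum_ite_mem, Finset.univ_inter, Finset.sum_add_distrib]
    have e2 : ∀ i : Fin n, j = π.symm (ζ i) ↔ ζ.symm (π j) = i :=
      fun i => by rw [Equiv.eq_symm_apply, Equiv.symm_apply_eq]
    have e1 : ∀ i : Fin n, j = π.symm i ↔ π j = i := fun i => Equiv.eq_symm_apply π
    simp_rw [e2, e1, Finset.sum_ite_eq, if_neg hA, if_neg hA']
    rfl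

/-! ### The cycle `(finRotate a).extendDomain eA` preserves the block -/

/-- A permutation of `Fin a` extended along `eA : Fin a ≃ A` maps `A` to itself and fixes the
complement, so it preserves membership in `A`. [folklore] -/
theorem extendDomain_mem_iff {n a : ℕ} (A : Finset (Fin n)) (eA : Fin a ≃ {i // i ∈ A})
    (σ : Equiv.Perm (Fin a)) (i : Fin n) : σ.extendDomain eA i ∈ A ↔ i ∈ A := by
  by_cases h : i ∈ A
  · rw [Equiv.Perm.extendDomain_apply_subtype σ eA h]
    exact iff_of_true (eA _).2 h
  · rw [Equiv.Perm.extendDomain_apply_not_subtype σ eA h]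

/-! ### The two-band table on a block -/

/-- **Two-band tables along a cycle on a row block.**  Let `A, B ⊆ Fin n` with `π (B) = A`
(`j ∈ B ↔ π j ∈ A`), `eA : Fin a ≃ A` a cyclic order of `A` and `ζ = (finRotate a).extendDomain eA`.
If `Σ_{i ∈ A} R' i = Σ_{j ∈ B} C' j`, `R' i ≤ C' j + W` and `C' j ≤ R' i + W` for `i ∈ A`, `j ∈ B`,
and `a · W + 1 ≤ R' i` for `i ∈ A`, then there is a table `L : Fin n × Fin n →₀ ℕ` supported on
cells `(i, j)` with `i ∈ A` and `π j = i ∨ π j = ζ i`, with row sums `R'` on `A` and `0` off `A`,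
and column sums `C'` on `B` and `0` off `B`. [folklore] -/
theorem stub_twoBandTableOn :
    ∀ (n a : ℕ) (A B : Finset (Fin n)) (eA : Fin a ≃ {i // i ∈ A}) (π : Equiv.Perm (Fin n))
      (R' C' : Fin n → ℕ) (W : ℕ),
      (∀ j, j ∈ B ↔ π j ∈ A) →
      ∑ i ∈ A, R' i = ∑ j ∈ B, C' j →
      (∀ i ∈ A, ∀ j ∈ B, R' i ≤ C' j + W ∧ C' j ≤ R' i + W) →
      (∀ i ∈ A, a * W + 1 ≤ R' i) →
      ∃ L : (Fin n × Fin n) →₀ ℕ,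
        (∀ e ∈ L.support, e.1 ∈ A ∧ (π e.2 = e.1 ∨ π e.2 = ((finRotate a).extendDomain eA) e.1)) ∧
        (∀ i ∈ A, ∑ j, L (i, j) = R' i) ∧ (∀ i ∉ A, ∑ j, L (i, j) = 0) ∧
        (∀ j ∈ B, ∑ i, L (i, j) = C' j) ∧ (∀ j ∉ B, ∑ i, L (i, j) = 0) := by
  intro n a A B eA π R' C' W hB hbal hclose hoff
  cases a with
  | zero =>
    -- `A = ∅`: the zero potential works vacuously
    exact table_of_potential_on A B π _ hB (extendDomain_mem_iff A eA _) R' C' 0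
      (fun i _ => Nat.zero_le _) fun i hi => (eA.symm ⟨i, hi⟩).elim0
  | succ m =>
    -- the defects `D k = R' (eA k) - C' (π⁻¹ (eA k))` along the cyclic order sum to zero and lie
    -- in `[-W, W]`
    have hmemB : ∀ k : Fin (m + 1), π.symm (eA k) ∈ B := fun k => by
      rw [hB, Equiv.apply_symm_apply]; exact (eA k).2
    set D : Fin (m + 1) → ℤ := fun k => (R' (eA k) : ℤ) - C' (π.symm (eA k)) with hD
    have hD0 : ∑ k, D k = 0 := by
      have hR : ∑ k, (R' (eA k) : ℤ) = ∑ i ∈ A, (R' i : ℤ) := by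
        rw [← Finset.sum_coe_sort A]
        exact Equiv.sum_comp eA (fun i => (R' (i : Fin n) : ℤ))
      have hC1 : ∑ k, (C' (π.symm (eA k)) : ℤ) = ∑ i ∈ A, (C' (π.symm i) : ℤ) := by
        rw [← Finset.sum_coe_sort A]
        exact Equiv.sum_comp eA (fun i => (C' (π.symm (i : Fin n)) : ℤ))
      have hC2 : ∑ j ∈ B, (C' j : ℤ) = ∑ i ∈ A, (C' (π.symm i) : ℤ) :=
        Finset.sum_equiv π hB fun j _ => by simp
      simp only [hD]
      rw [Finset.sum_sub_distrib, hR, hC1, ← hC2, sub_eq_zero]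
      exact_mod_cast hbal
    have hDB : ∀ k, -(W : ℤ) ≤ D k ∧ D k ≤ W := by
      intro k
      obtain ⟨h1, h2⟩ := hclose (eA k) (eA k).2 (π.symm (eA k)) (hmemB k)
      simp only [hD]
      constructor <;> omega
    obtain ⟨Y, hYstep, hY0, hYle⟩ := exists_potential m D hD0 W hDB
    -- transport the potential to `Fin n` (zero off `A`)
    set y : Fin n → ℕ := fun i => if h : i ∈ A then (Y (eA.symm ⟨i, h⟩)).toNat else 0 with hy_def
    have hy_eA : ∀ k, y (eA k) = (Y k).toNat := by
      intro k
      simp only [hy_def, dif_pos (eA k).2, Subtype.coe_eta, Equiv.symm_apply_apply]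
    -- `y ≤ m W < (m + 1) W + 1 ≤ R'`
    have hyR : ∀ k, (Y k).toNat ≤ R' (eA k) := by
      intro k
      rw [Int.toNat_le]
      have h1 := hYle k
      have h2 : (((m + 1) * W + 1 : ℕ) : ℤ) ≤ R' (eA k) := by exact_mod_cast hoff (eA k) (eA k).2
      have hW : (0 : ℤ) ≤ W := by positivity
      push_cast at h1 h2
      nlinarith
    refine table_of_potential_on A B π _ hB (extendDomain_mem_iff A eA _) R' C' y ?_ ?_
    · intro i hi
      obtain ⟨k, rfl⟩ : ∃ k, (eA k : Fin n) = i := ⟨eA.symm ⟨i, hi⟩, by simp⟩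
      rw [hy_eA]
      exact hyR k
    · intro i hi
      obtain ⟨k, rfl⟩ : ∃ k, (eA k : Fin n) = i := ⟨eA.symm ⟨i, hi⟩, by simp⟩
      rw [Equiv.Perm.extendDomain_apply_image, hy_eA, hy_eA]
      have h1 := hyR (finRotate (m + 1) k)
      have h := hYstep k
      simp only [hD] at h
      have key : ((R' (eA (finRotate (m + 1) k)) - (Y (finRotate (m + 1) k)).toNat
            + (Y k).toNat : ℕ) : ℤ) = C' (π.symm (eA (finRotate (m + 1) k))) := by
        rw [Nat.cast_add, Nat.cast_sub h1, Int.toNat_of_nonneg (hY0 _),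
          Int.toNat_of_nonneg (hY0 _)]
        linarith
      exact_mod_cast key

end Summit.ValiantsHypothesis.ValiantsHypothesis.Theorems.DivisionGap.PerMultiplesHard.TwoBandTableOn
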